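import Summits.CriticalPhenomena.Ising3D.Control2DGFFChiralSeries
import Summits.CriticalPhenomena.Ising3D.Control2DIsland
import Mathlib.Tactic
import HarnessLib

/-!
# Non-vacuity of the 2D control's typed hypothesis class: the generalised free field witness
(cell `pub-ising3x`, seat controls-1 gen 35; step 3 of 3 — CONTROL-ONLY)

HONEST FRAMING: lottery ticket; floor = tightest certified 3D Ising CFT bounds; no exact-solution
claim without a proof. CONTROL-ONLY (`d = 2`, `Δ_σ = s`; the witness is the generalised free field,
NOT the 2D Ising CFT); nothing numerical is asserted here.

Every typed statement of the 2D blind control — `GapExcluded s U`, `OpeBound s gap P`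
(`Control2DBootstrap`), `BoxExcluded`, `ExcludedAt`, `ExcludedOn`, `TwoSided` (`Control2DIsland`), the
`ope2`/`ope2eps` kinds, and the ≈ 3 000 kernel certificate modules behind `Control2DRecord` — has the
form `∀ D : CrossingData, D.IsUnitary → D.SatisfiesCrossing s → …`. Such a statement is only as good as
its hypothesis class is consistent: were no `CrossingData` to satisfy `IsUnitary ∧ SatisfiesCrossing (1/8)`
in the tree's conventions (`crossF s (-1)`, the closed-form `globalBlock`, the `HasSum` form of the sum
rule), every certificate would certify a vacuous truth (the 3D chain met exactly this risk: the A3 sign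
erratum, closed by `Literature/…/SingleCorrelatorNonVacuity` + `MeanFieldDecomposition`). This file
closes the gap for the 2D control, for EVERY column `s > 0`:

* `gffData2D s` — the two-dimensional generalised free field of dimension `Δ_φ = s` as a
  `CrossingData`: labels `(n, m) ∈ ℕ²` with `n + m` even, `Δ = 2s + n + m`, `ℓ = |n - m|`,
  `p = b_n(s) b_m(s)` (`b = gffChiralCoeff`);
* `hasSum_gffData2D_blocks` — `Σ_i p_i g_{Δ_i,ℓ_i}(z,z̄) = (z z̄)^s + (z z̄/((1-z)(1-z̄)))^s = 𝒢 - 1`,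
  `𝒢 = 1 + u^s + (u/v)^s`, on the open square (from the chiral expansions of
  `Control2DGFFChiralSeries`, `[n + m even] = (1 + (-1)^{n+m})/2`);
* `gffData2D_isUnitary`, `gffData2D_satisfiesCrossing`, `gffData2D_hasScalarGap`,
  `gffData2D_scalarsIn` — the witness is unitary, solves the `⟨σσσσ⟩` sum rule at `Δ_σ = s`
  (`v^s(𝒢-1)(z,z̄) - u^s(𝒢-1)(1-z,1-z̄) = u^s - v^s = -F_-[1]`), and has scalars exactly `{2s + 2n}`;
* `crossingData_nonvacuous` — **`∃ D, D.IsUnitary ∧ D.SatisfiesCrossing s ∧ D.HasScalarGap (2s)`** for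
  every `s > 0`; `not_gapExcluded_of_le_two_mul` — **`¬ GapExcluded s U` for `U ≤ 2s`**;
* the control's column `s = 1/8`: `crossingData_nonvacuous_eighth`, `not_gapExcluded_2d_quarter`
  (`¬ GapExcluded (1/8) (1/4)`; with `Control2DRecord.record_oneSided`'s `GapExcluded (1/8) (20001/20000)`
  the threshold of the typed one-sided item is pinned in `(1/4, 1.00005]`).

What is NOT witnessed here: the `A2D′` sub-classes at `s = 1/8` with `(G, δ) = (2, 1)` (`ExcludedAt`,
`TwoSided`: the free field at `s = 1/8` has its first spin-2 quasi-primary at `9/4 < 3` and no stress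
tensor) and the gap classes `HasScalarGap U`, `U > 1/4` (`OpeBound`'s hypothesis) — their natural
witness is the 2D Ising datum itself (Virasoro), not constructed in the tree.

References: I. Heemskerk, J. Penedones, J. Polchinski, J. Sully, JHEP 10 (2009) 079, §2
[cite: HeemskerkPenedonesPolchinskiSully2009, §2]; A. L. Fitzpatrick, J. Kaplan, JHEP 10 (2012) 032,
§2.2 [cite: FitzpatrickKaplan2012, §2.2]; R. Rattazzi, V. S. Rychkov, E. Tonni, A. Vichi, JHEP 12
(2008) 031, §3 eq. (3.6) [cite: RattazziEtAl2008, §3 eq. (3.6)]; F. A. Dolan, H. Osborn, Nucl. Phys.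
B 678 (2004) 491, §3 [cite: DolanOsborn2004, §3]. Tree: `CrossingData`, `IsUnitary`,
`SatisfiesCrossing`, `HasScalarGap`, `GapExcluded`, `globalBlock`, `chiralBlock` (`Control2DBootstrap`),
`ScalarsIn` (`Control2DIsland`), `hasSum_gffChiral_ratio/pow` (`Control2DGFFChiralSeries`).
-/

namespace Summit.CriticalPhenomena.Ising3D.Control2D

open Finset Set
open Literature.MathematicalPhysics.QuantumFieldTheory.ConformalBootstrap3D

section NonVacuity

variable {s z zb : ℝ}

/-- `k_{2h}(x) ≥ 0` for `h ≥ 0`, `0 < x < 1` (a series of non-negative terms). [folklore] -/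
theorem chiralBlock_nonneg {h x : ℝ} (hh : 0 ≤ h) (hx : x ∈ Ioo (0 : ℝ) 1) : 0 ≤ chiralBlock h x :=
  (hasSum_chiralBlock h hx.1 hx.2).nonneg fun m =>
    mul_nonneg (chiralCoeff_nonneg hh m) (Real.rpow_nonneg hx.1.le _)

/-- The even-pair weight: `c(n,m) = b_n b_m` if `n + m` is even, else `0`. [folklore] -/
noncomputable def gffPairCoeff (s : ℝ) (nm : ℕ × ℕ) : ℝ :=
  if Even (nm.1 + nm.2) then gffChiralCoeff s nm.1 * gffChiralCoeff s nm.2 else 0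

/-- **The pair expansion of `u^s + (u/v)^s`.** For `s > 0` and `(z, z̄)` in the open square,
`Σ_{(n,m)} c(n,m) (k_{2(s+n)}(z) k_{2(s+m)}(z̄) + k_{2(s+m)}(z) k_{2(s+n)}(z̄)) = (z z̄)^s + (z z̄/((1-z)(1-z̄)))^s`
(`HasSum` over `ℕ × ℕ`): products of the two chiral expansions, `(1 + (-1)^{n+m})/2 = [n+m even]`,
symmetrised under `(n,m) ↔ (m,n)`. [cite: FitzpatrickKaplan2012, §2.2] -/
theorem hasSum_gff_pairs (hs : 0 < s) (hz : z ∈ Ioo (0 : ℝ) 1) (hzb : zb ∈ Ioo (0 : ℝ) 1) :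
    HasSum (fun nm : ℕ × ℕ => gffPairCoeff s nm *
        (chiralBlock (s + nm.1) z * chiralBlock (s + nm.2) zb +
          chiralBlock (s + nm.2) z * chiralBlock (s + nm.1) zb))
      ((z * zb) ^ s + ((z * zb) / ((1 - z) * (1 - zb))) ^ s) := by
  obtain ⟨f, hf_def⟩ : ∃ f : ℕ → ℝ, f = fun n => gffChiralCoeff s n * chiralBlock (s + n) z := ⟨_, rfl⟩
  obtain ⟨g, hg_def⟩ : ∃ g : ℕ → ℝ, g = fun m => gffChiralCoeff s m * chiralBlock (s + m) zb := ⟨_, rfl⟩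
  have hf : HasSum f ((z / (1 - z)) ^ s) := hf_def ▸ hasSum_gffChiral_ratio hs hz
  have hg : HasSum g ((zb / (1 - zb)) ^ s) := hg_def ▸ hasSum_gffChiral_ratio hs hzb
  have hf0 : 0 ≤ f := fun n => by
    rw [hf_def]
    exact mul_nonneg (gffChiralCoeff_nonneg hs n) (chiralBlock_nonneg (by positivity) hz)
  have hg0 : 0 ≤ g := fun m => by
    rw [hg_def]
    exact mul_nonneg (gffChiralCoeff_nonneg hs m) (chiralBlock_nonneg (by positivity) hzb)
  have hP : Summable fun nm : ℕ × ℕ => f nm.1 * g nm.2 := hf.summable.mul_of_nonneg hg.summable hf0 hg0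
  have P1 : HasSum (fun nm : ℕ × ℕ => f nm.1 * g nm.2) ((z / (1 - z)) ^ s * (zb / (1 - zb)) ^ s) :=
    hf.mul hg hP
  have hf' : HasSum (fun n => (-1 : ℝ) ^ n * f n) (z ^ s) := hf_def ▸ hasSum_gffChiral_pow hs hz
  have hg' : HasSum (fun m => (-1 : ℝ) ^ m * g m) (zb ^ s) := hg_def ▸ hasSum_gffChiral_pow hs hzb
  have hP' : Summable fun nm : ℕ × ℕ => ((-1 : ℝ) ^ nm.1 * f nm.1) * ((-1 : ℝ) ^ nm.2 * g nm.2) := by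
    refine Summable.of_norm_bounded hP fun nm => le_of_eq ?_
    simp only [norm_mul, norm_pow, norm_neg, norm_one, one_pow, one_mul,
      Real.norm_of_nonneg (hf0 nm.1), Real.norm_of_nonneg (hg0 nm.2)]
  have P2 : HasSum (fun nm : ℕ × ℕ => ((-1 : ℝ) ^ nm.1 * f nm.1) * ((-1 : ℝ) ^ nm.2 * g nm.2))
      (z ^ s * zb ^ s) := hf'.mul hg' hP'
  have S := P1.add P2
  have S' := (Equiv.prodComm ℕ ℕ).hasSum_iff.mpr S
  have T := (S.add S').div_const 2
  have key : HasSum (fun nm : ℕ × ℕ => gffPairCoeff s nm *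
      (chiralBlock (s + nm.1) z * chiralBlock (s + nm.2) zb +
        chiralBlock (s + nm.2) z * chiralBlock (s + nm.1) zb))
      (((z / (1 - z)) ^ s * (zb / (1 - zb)) ^ s + z ^ s * zb ^ s +
        ((z / (1 - z)) ^ s * (zb / (1 - zb)) ^ s + z ^ s * zb ^ s)) / 2) := by
    refine T.congr_fun fun nm => ?_
    obtain ⟨n, m⟩ := nm
    simp only [hf_def, hg_def, Function.comp_apply, Equiv.prodComm_apply, Prod.swap_prod_mk,
      gffPairCoeff]
    by_cases he : Even (n + m)
    · rw [if_pos he]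
      have hε : (-1 : ℝ) ^ n * (-1 : ℝ) ^ m = 1 := by rw [← pow_add, he.neg_one_pow]
      linear_combination (-(gffChiralCoeff s n * gffChiralCoeff s m *
        (chiralBlock (s + n) z * chiralBlock (s + m) zb + chiralBlock (s + m) z * chiralBlock (s + n) zb) / 2)) * hε
    · rw [if_neg he]
      have ho : Odd (n + m) := Nat.not_even_iff_odd.mp he
      have hε : (-1 : ℝ) ^ n * (-1 : ℝ) ^ m = -1 := by rw [← pow_add, ho.neg_one_pow]
      linear_combination (-(gffChiralCoeff s n * gffChiralCoeff s m *
        (chiralBlock (s + n) z * chiralBlock (s + m) zb + chiralBlock (s + m) z * chiralBlock (s + n) zb) / 2)) * hε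
  have hv : ((z / (1 - z)) ^ s * (zb / (1 - zb)) ^ s + z ^ s * zb ^ s +
      ((z / (1 - z)) ^ s * (zb / (1 - zb)) ^ s + z ^ s * zb ^ s)) / 2 =
      (z * zb) ^ s + ((z * zb) / ((1 - z) * (1 - zb))) ^ s := by
    have h1z : 0 ≤ 1 - z := by linarith [hz.2]
    have h1zb : 0 ≤ 1 - zb := by linarith [hzb.2]
    rw [Real.mul_rpow hz.1.le hzb.1.le, ← div_mul_div_comm,
      Real.mul_rpow (div_nonneg hz.1.le h1z) (div_nonneg hzb.1.le h1zb)]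
    ring
  rw [← hv]
  exact key

/-- The index type of the witness: ordered pairs `(n, m)` of chiral levels with `n + m` even
(even spin `|n - m|`). [folklore] -/
abbrev GffIndex : Type := {nm : ℕ × ℕ // Even (nm.1 + nm.2)}

/-- **The two-dimensional generalised free field of dimension `Δ_φ = s` as a `CrossingData`.**
Labels: ordered pairs `(n, m)` with `n + m` even; the label `(n, m)` carries the quasi-primary of
weights `(h, h̄) = (s + max, s + min)`, i.e. `Δ = 2s + n + m`, `ℓ = |n - m|`, with coefficient
`b_n(s) b_m(s)`. (The double-twist operator `[φφ]` with `{h, h̄} = {s+n, s+m}`, `n ≠ m`, is thus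
entered under the two labels `(n,m)` and `(m,n)` — a degenerate relabelling, harmless for a
`CrossingData`; its total squared OPE coefficient in the normalisation of `globalBlock` is `2 b_n b_m`,
and `b_n²` for `n = m`.) [cite: FitzpatrickKaplan2012, §2.2] -/
noncomputable def gffData2D (s : ℝ) : CrossingData where
  ι := GffIndex
  Δ := fun i => 2 * s + i.1.1 + i.1.2
  spin := fun i => max i.1.1 i.1.2 - min i.1.1 i.1.2
  p := fun i => gffChiralCoeff s i.1.1 * gffChiralCoeff s i.1.2

/-- The parity-symmetrised global block of the label `(n, m)` is
`k_{2(s+n)}(z) k_{2(s+m)}(z̄) + k_{2(s+m)}(z) k_{2(s+n)}(z̄)`. [cite: DolanOsborn2004, §3] -/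
theorem globalBlock_gff_pair (s : ℝ) (n m : ℕ) (z zb : ℝ) :
    globalBlock (2 * s + n + m) (max n m - min n m) z zb =
      chiralBlock (s + n) z * chiralBlock (s + m) zb + chiralBlock (s + m) z * chiralBlock (s + n) zb := by
  unfold globalBlock
  rcases le_total n m with h | h
  · rw [max_eq_right h, min_eq_left h, Nat.cast_sub h,
      show (2 * s + (n : ℝ) + m + ((m : ℝ) - n)) / 2 = s + m by ring,
      show (2 * s + (n : ℝ) + m - ((m : ℝ) - n)) / 2 = s + n by ring]
    ring
  · rw [max_eq_left h, min_eq_right h, Nat.cast_sub h,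
      show (2 * s + (n : ℝ) + m + ((n : ℝ) - m)) / 2 = s + n by ring,
      show (2 * s + (n : ℝ) + m - ((n : ℝ) - m)) / 2 = s + m by ring]

/-- **Block expansion of the generalised free four-point function**: for `s > 0` and `(z, z̄)` in the
open square, `Σ_i p_i g_{Δ_i, ℓ_i}(z, z̄) = (z z̄)^s + (z z̄ /((1-z)(1-z̄)))^s = 𝒢(z,z̄) - 1`,
`𝒢 = 1 + u^s + (u/v)^s`. [cite: HeemskerkPenedonesPolchinskiSully2009, §2] -/
theorem hasSum_gffData2D_blocks (hs : 0 < s) (hz : z ∈ Ioo (0 : ℝ) 1) (hzb : zb ∈ Ioo (0 : ℝ) 1) :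
    HasSum (fun i : (gffData2D s).ι =>
        (gffData2D s).p i * globalBlock ((gffData2D s).Δ i) ((gffData2D s).spin i) z zb)
      ((z * zb) ^ s + ((z * zb) / ((1 - z) * (1 - zb))) ^ s) := by
  have h := hasSum_gff_pairs hs hz hzb
  have hsupp : Function.support (fun nm : ℕ × ℕ => gffPairCoeff s nm *
      (chiralBlock (s + nm.1) z * chiralBlock (s + nm.2) zb +
        chiralBlock (s + nm.2) z * chiralBlock (s + nm.1) zb)) ⊆ {nm : ℕ × ℕ | Even (nm.1 + nm.2)} := by
    intro nm hnm
    by_contra he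
    apply hnm
    have he' : ¬ Even (nm.1 + nm.2) := he
    simp only [gffPairCoeff, if_neg he', zero_mul]
  have h2 := (hasSum_subtype_iff_of_support_subset hsupp).2 h
  refine h2.congr_fun fun i => ?_
  obtain ⟨⟨n, m⟩, he⟩ := i
  have he' : Even (n + m) := he
  simp only [Function.comp_apply, gffData2D, gffPairCoeff, if_pos he']
  rw [globalBlock_gff_pair]

/-- **Unitarity of the witness**: even spins, `Δ ≥ ℓ`, `p ≥ 0` (for `s > 0`). [folklore] -/
theorem gffData2D_isUnitary (hs : 0 < s) : (gffData2D s).IsUnitary := by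
  intro i
  obtain ⟨⟨n, m⟩, he⟩ := i
  have he' : Even (n + m) := he
  refine ⟨?_, ?_, ?_⟩
  · show Even (max n m - min n m)
    rw [Nat.even_sub (min_le_max)]
    rcases le_total n m with h | h
    · rw [max_eq_right h, min_eq_left h]
      exact (Nat.even_add.mp he').symm
    · rw [max_eq_left h, min_eq_right h]
      exact Nat.even_add.mp he'
  · show ((max n m - min n m : ℕ) : ℝ) ≤ 2 * s + n + m
    have h1 : (max n m - min n m : ℕ) ≤ n + m :=
      le_trans (Nat.sub_le _ _) (max_le (Nat.le_add_right n m) (Nat.le_add_left m n))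
    have h2 : ((max n m - min n m : ℕ) : ℝ) ≤ ((n + m : ℕ) : ℝ) := Nat.cast_le.mpr h1
    push_cast at h2
    linarith
  · show 0 ≤ gffChiralCoeff s n * gffChiralCoeff s m
    exact mul_nonneg (gffChiralCoeff_nonneg hs n) (gffChiralCoeff_nonneg hs m)

/-- **Crossing of the witness**: the generalised free field solves the `⟨σσσσ⟩` sum rule at
`Δ_σ = s` (`s > 0`) in the tree's conventions (`crossF s (-1)`, `globalBlock`):
`Σ_i p_i F_-[g_i](z,z̄) = -F_-[1](z,z̄)`, from `v^s (𝒢 - 1)(z,z̄) - u^s (𝒢 - 1)(1-z,1-z̄) = u^s - v^s`.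
[cite: RattazziEtAl2008, §3 eq. (3.6)] -/
theorem gffData2D_satisfiesCrossing (hs : 0 < s) : (gffData2D s).SatisfiesCrossing s := by
  intro z zb hz hzb
  have hz' : 1 - z ∈ Ioo (0 : ℝ) 1 := ⟨by linarith [hz.2], by linarith [hz.1]⟩
  have hzb' : 1 - zb ∈ Ioo (0 : ℝ) 1 := ⟨by linarith [hzb.2], by linarith [hzb.1]⟩
  have A := (hasSum_gffData2D_blocks hs hz hzb).mul_left (((1 - z) * (1 - zb)) ^ s)
  have B := (hasSum_gffData2D_blocks hs hz' hzb').mul_left ((-1) * (z * zb) ^ s)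
  have AB := A.add B
  have hu : 0 < (z * zb) ^ s := Real.rpow_pos_of_pos (mul_pos hz.1 hzb.1) s
  have hv : 0 < ((1 - z) * (1 - zb)) ^ s := Real.rpow_pos_of_pos (mul_pos hz'.1 hzb'.1) s
  have hval : ((1 - z) * (1 - zb)) ^ s * ((z * zb) ^ s + ((z * zb) / ((1 - z) * (1 - zb))) ^ s) +
      (-1) * (z * zb) ^ s * (((1 - z) * (1 - zb)) ^ s +
        (((1 - z) * (1 - zb)) / ((1 - (1 - z)) * (1 - (1 - zb)))) ^ s) =
      -(crossF s (-1) (fun _ _ => (1 : ℝ)) z zb) := by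
    simp only [crossF, sub_sub_cancel]
    rw [Real.div_rpow (mul_pos hz.1 hzb.1).le (mul_pos hz'.1 hzb'.1).le,
      Real.div_rpow (mul_pos hz'.1 hzb'.1).le (mul_pos hz.1 hzb.1).le]
    field_simp
    ring
  rw [← hval]
  refine AB.congr_fun fun i => ?_
  simp only [crossF]
  ring

/-- Every dimension of the witness is at least `2s`. [folklore] -/
theorem gffData2D_le_dim (s : ℝ) (i : (gffData2D s).ι) : 2 * s ≤ (gffData2D s).Δ i := by
  obtain ⟨⟨n, m⟩, _⟩ := i
  show 2 * s ≤ 2 * s + n + m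
  have hn : (0 : ℝ) ≤ n := Nat.cast_nonneg n
  have hm : (0 : ℝ) ≤ m := Nat.cast_nonneg m
  linarith

/-- **Scalar gap of the witness**: every scalar has `Δ ≥ 2s` (indeed the scalars are exactly
`2s + 2n`, `gffData2D_scalarsIn`). [folklore] -/
theorem gffData2D_hasScalarGap (s : ℝ) : (gffData2D s).HasScalarGap (2 * s) :=
  fun i _ => gffData2D_le_dim s i

/-- The scalars of the witness are `{2s + 2n : n ∈ ℕ}` (`ℓ = 0` iff `n = m`). [folklore] -/
theorem gffData2D_scalarsIn (s : ℝ) :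
    (gffData2D s).ScalarsIn (Set.range fun n : ℕ => 2 * s + 2 * n) := by
  intro i hi
  obtain ⟨⟨n, m⟩, _⟩ := i
  have hi' : max n m - min n m = 0 := hi
  have hnm : n = m := by
    have := Nat.sub_eq_zero_iff_le.mp hi'
    rcases le_total n m with h | h
    · rw [max_eq_right h, min_eq_left h] at this; omega
    · rw [max_eq_left h, min_eq_right h] at this; omega
  subst hnm
  refine ⟨n, ?_⟩
  show 2 * s + 2 * (n : ℝ) = 2 * s + n + n
  ring

/-- **NON-VACUITY of the 2D control's hypothesis class.** For every external dimension `s > 0` there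
is a parity-symmetric unitary solution of the two-dimensional `⟨σσσσ⟩` sum rule with global blocks —
the generalised free field — with scalar gap `2s`. Hence the common hypothesis
`IsUnitary ∧ SatisfiesCrossing s` of `GapExcluded`, `OpeBound`, `BoxExcluded`, `ExcludedAt`,
`TwoSided`, … is satisfiable at every `s > 0` (in particular at the control's `s = 1/8`), in the
tree's sign and normalisation conventions. [cite: HeemskerkPenedonesPolchinskiSully2009, §2] -/
theorem crossingData_nonvacuous (hs : 0 < s) :
    ∃ D : CrossingData, D.IsUnitary ∧ D.SatisfiesCrossing s ∧ D.HasScalarGap (2 * s) :=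
  ⟨gffData2D s, gffData2D_isUnitary hs, gffData2D_satisfiesCrossing hs, gffData2D_hasScalarGap s⟩

/-- **No gap at or below `2Δ_σ` is excludable**: `¬ GapExcluded s U` for `U ≤ 2s` (the generalised
free field has all its scalars at `Δ ≥ 2s`). The typed one-sided item is therefore not vacuous: the
set of excluded gaps at `Δ_σ = s` is a proper up-set of `(2s, ∞)`. [folklore] -/
theorem not_gapExcluded_of_le_two_mul (hs : 0 < s) {U : ℝ} (hU : U ≤ 2 * s) : ¬ GapExcluded s U :=
  fun h => h (gffData2D s) (gffData2D_isUnitary hs) (gffData2D_satisfiesCrossing hs)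
    ((gffData2D_hasScalarGap s).mono hU)

/-- **The 2D Ising column**: at `Δ_σ = 1/8` the gap `1/4 = 2Δ_σ` is NOT excluded (kernel; compare the
certified exclusions `GapExcluded (1/8) U` for `U ≥ 20001/20000` of `Control2DRecord.record_oneSided`:
the threshold of the typed one-sided item lies in `(1/4, 1.00005]`). [folklore] -/
theorem not_gapExcluded_2d_quarter : ¬ GapExcluded (1 / 8 : ℝ) (1 / 4) :=
  not_gapExcluded_of_le_two_mul (by norm_num) (by norm_num)

/-- The hypothesis class of the 2D control at `Δ_σ = 1/8` is non-empty. [folklore] -/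
theorem crossingData_nonvacuous_eighth :
    ∃ D : CrossingData, D.IsUnitary ∧ D.SatisfiesCrossing (1 / 8 : ℝ) ∧ D.HasScalarGap (1 / 4) := by
  obtain ⟨D, h1, h2, h3⟩ := crossingData_nonvacuous (s := (1 / 8 : ℝ)) (by norm_num)
  exact ⟨D, h1, h2, by norm_num at h3; exact h3⟩

end NonVacuity

end Summit.CriticalPhenomena.Ising3D.Control2D
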